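import Summits.BirchSwinnertonDyer.BirchSwinnertonDyer.Theorems.AdditiveBranchIMCGordTwoRankOneHeegnerKolyvaginIstarDoorsCells
import Summits.BirchSwinnertonDyer.Rank1Residual.X11b.SelmerSubgroupCertificate
import HarnessLib

/-!
# Route `AdditiveBranchIMC` (rung K1), crux `GordTwoRankOne` (item 19358): the Heegner–Kolyvagin road,
# Part 23d — the `Iₙ*` doors with the LOWER half from an EXHIBITED `p`-Selmer SUBGROUP (x11b's LB3SUB
# currency: no class group, no GRH, no Cassels–Tate), every odd `p`; the (G) ∧ ss rank-one rows at `p = 3`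
# (cell `bsd-addord`, second prover lane `bsd-addord-k1-c3x`, gen 6; `--supports` only)

HONEST FRAMING. THEOREMS ONLY: no definition, no new named fact, no `sorry`; nothing is booked here; crux
19358 stays OPEN at class level; the (G) ∧ ss rows belong to cell `bsd-potss` at class level; BSD is not proved
by any of this. Part 23b/23c (`…IstarDoors[Cells]`) closed `BSD(E,p)` per pair at an additive `Iₙ*` prime from
PUBLISHED facts + ONE unit Heegner twist (UPPER) + the LOWER half either displayed, free, or from the count
`p^{r_an+1} ∣ #Sel^(p)(E/ℚ)` through b2b's Cassels–Tate door. THIS FILE replaces the last by the certificate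
currency x11b GEN 11 introduced and the books accepted for the X11b@3 tail (`X11b/SelmerSubgroupCertificate`,
`IsX11Three.bsdp_of_ram_of_not_dvd_of_card_addSubgroup_selmerThree_eq`): an EXHIBITED subgroup
`S ≤ Sel^(p)(E/ℚ)` with `#S = p^{1+j}` — `j+1` independent classes of `A^×/(A^×)^p` each verified to be Selmer
by its local images (Schaefer–Stoll), GRH-free — gives `p^j ∣ #Ш(E/ℚ)` by
`X11b.pow_dvd_shaOrder_of_card_addSubgroup_selmerGroup` (`rank E(ℚ) = r_an = 1` by GZK; `E(ℚ)[p] = 0` from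
`ρ̄_{E,p}` onto), hence LOWER(E,p) when `ord_p #Ш(E)_an ≤ j` — NO Cassels–Tate binder.

CENSUS USE (lane-B kit **j293463**, x11b GEN-11 LB3SUB kit BYTE-IDENTICAL — desc3lib.gp e6c495dc16da439b,
entry.gp b7e132cb877e7a05, engine_main.py c531a15a2d2f1330, verify3.gp d7f21bad976bc8b1, verify_main.py
0400af5186c31a44, indep3.gp af633bc19f42cd13, main.py 498ae2c688ea0a5e; 36 s wall): ALL EIGHT live rank-one
(G) ∧ ss residue classes at `p = 3` (`#Ш_an = 9`, `ρ̄_{E,3}` onto) — 182853c1, 228897c1, 250065g1, 355338h1,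
409248cy1, 439794p1, 205128l1, 133956n1 — carry an LB3SUB certificate: three exhibited `3`-Selmer classes,
verify3 ALL-CHECKS-PASS, indep3 INDEPENDENT (GRH-free) ⟹ `S ≤ Sel^(3)(E/ℚ)`, `#S = 27` (engine dim `= 3`, MATCH).
With kit j292847's unit Heegner twists for the first six (`d_K = −35, −23, −56, −71, −335, −95`;
`3 ∤ #Ш_an(E^{d_K})·∏c(E^{d_K})`, `3 ∤ ∏c(E)`) the theorem
`bsdp_rankOne_subGss_of_card_addSubgroup_selmer_of_twistShaAnUnit` below is the per-pair road to `BSD(E,3)`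
on those six — PUBLISHED binders hGZ hKo hB hGZK hmod hnf + cite-only hMz hAU hC2, the subgroup certificate,
the twist datum (one PARI engine so far; a second value engine is owed before any offer). Nothing booked here.

References: [SchaeferStoll2004] §1, §5; [SilvermanAEC2009] X.4.2(a); [JetchevSkinnerWan2017] §7.4.1–7.4.3;
[KolyvaginEulerSystems1990] Thm. A; [McCallumLMS1991] §1; [Mazur1977] III.§5; [Miller2011LMS] Def. 1.1.
-/

set_option autoImplicit false
set_option linter.dupNamespace false
noncomputable section
open scoped Classical NumberField
open WeierstrassCurve NumberField IsDedekindDomain IsDedekindDomain.HeightOneSpectrum Rat.HeightOneSpectrum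
  Literature.NumberTheory.DiophantineGeometry Literature.NumberTheory.EllipticCurves
  Literature.NumberTheory.EllipticCurves.ModularForms Literature.NumberTheory.EllipticCurves.Rank1Residual
  Literature.NumberTheory.EllipticCurves.Rank1Residual.Typed Literature.NumberTheory.Automorphic
  Summit.BirchSwinnertonDyer.Rank1Residual Summit.BirchSwinnertonDyer.Rank1Residual.Additive
  Summit.BirchSwinnertonDyer.Rank1Residual.X11b Summit.BirchSwinnertonDyer.Rank1Residual.GaloisImage
  Summit.BirchSwinnertonDyer.BirchSwinnertonDyer.Theses.AdditiveKolyvaginRoad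
  Summit.BirchSwinnertonDyer.BirchSwinnertonDyer.Theorems.AdditiveKolyvaginKernel
  Summit.BirchSwinnertonDyer.BirchSwinnertonDyer.Theorems

namespace Summit.BirchSwinnertonDyer.BirchSwinnertonDyer.Theorems.AdditiveBranchIMCGordTwoRankOne.HeegnerKolyvagin

/-! ### §18 LOWER(E,p) in rank one from an exhibited Selmer subgroup (no Cassels–Tate) -/

/-- **LOWER(E,p) at a rank-one pair from an EXHIBITED subgroup `S ≤ Sel^(p)(E/ℚ)` of order `p^{1+j}` and
`ord_p #Ш(E)_an ≤ j`** (`ρ̄_{E,p}` onto ⇒ `E(ℚ)[p] = 0`; GZK ⇒ `rank E(ℚ) = r_an = 1`, `Ш` finite;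
x11b's `pow_dvd_shaOrder_of_card_addSubgroup_selmerGroup` + `missingLowerBoundAt_of_pow_dvd`). No Cassels–Tate,
no class group. [cite: SilvermanAEC2009, Thm. X.4.2(a)] [cite: SchaeferStoll2004, §1 and §5]
[cite: Mazur1977, Ch. III §5, p. 157] [cite: Miller2011LMS, Def. 1.1] -/
theorem missingLowerBoundAt_rankOne_of_surj_of_card_addSubgroup_selmer
    (hGZK : rank_eq_analyticRank_of_analyticRank_le_one)
    (W : WeierstrassCurve ℚ) [W.IsElliptic] (p : ℕ) [Fact p.Prime]
    (hr : W.analyticRank = 1) (hsurj : W.HasSurjectiveModNGaloisRep p)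
    {j : ℕ} {S : AddSubgroup (W.galH1Torsion (p : ℤ))} (hS : S ≤ W.selmerGroup (p : ℤ))
    (hcardS : Nat.card S = p ^ (1 + j)) {q : ℚ} (hq : shaAn W = (q : ℂ)) (hv : padicValRat p q ≤ j) :
    Typed.MissingLowerBoundAt W p := by
  obtain ⟨hrk, hfin⟩ := hGZK W (by omega)
  have hirr : Irr W p := hasIrreducibleModPGaloisRep_of_hasSurjectiveModNGaloisRep W p hsurj
  have hdvd : p ^ j ∣ W.shaOrder :=
    pow_dvd_shaOrder_of_card_addSubgroup_selmerGroup W p (j := j) hS (by rw [hrk, hr]; exact hcardS)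
      ((natCard_torsionBy_point_eq_of_subsingleton W _ _ _).trans
        (natCard_torsionBy_eq_one_of_hasIrreducibleModPGaloisRep W p hirr))
  exact missingLowerBoundAt_of_pow_dvd W p hfin hq hv hdvd

/-! ### §19 `BSD(E,p)` at an additive `Iₙ*` prime: UPPER from ONE unit Heegner twist, LOWER from the subgroup -/

/-- **`BSD(E,p)` per pair at an ADDITIVE prime of Kodaira type `Iₙ*`, every odd `p`: UPPER from PUBLISHED facts +
ONE unit Heegner twist (Part 23b §15), LOWER from an EXHIBITED Selmer subgroup of order `p^{1+j}` with
`ord_p #Ш(E)_an ≤ j` (§18).** Row: `r_an = 1`, `p` odd, `E` additive at `p` of type `Iₙ*` (`hI`), `ρ̄_{E,p}` onto,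
`p ∤ ∏c(E)`; data: Heegner `K` with `L(E^{d_K},1) ≠ 0`, globally minimal `Wd = Cd • E^{d_K}`,
`#Ш(Wd)_an = qd` with `ord_p qd ≤ 0`; `#Ш(E)_an = q`, `ord_p q ≤ j`; `S ≤ Sel^(p)(E/ℚ)`, `#S = p^{1+j}`.
[cite: JetchevSkinnerWan2017, §7.4.1–7.4.3 (pp. 29–31)] [cite: McCallumLMS1991, §1 Theorem (Kolyvagin), p. 296]
[cite: SilvermanAEC2009, Thm. X.4.2(a)] [cite: SchaeferStoll2004, §1 and §5] [cite: Miller2011LMS, §1 and Def. 1.1] -/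
theorem bsdp_rankOne_istar_of_card_addSubgroup_selmer_of_twistShaAnUnit
    (hGZ : ∀ (N : ℕ) [NeZero N] (W : WeierstrassCurve ℚ) (K : Type) [Field K] [NumberField K],
      gross_zagier N W K)
    (hKo : ∀ (N : ℕ) [NeZero N] (W : WeierstrassCurve ℚ) (K : Type) [Field K] [NumberField K],
      kolyvagin N W K)
    (hB : ∀ (N : ℕ) [NeZero N] (W : WeierstrassCurve ℚ) (K : Type) [Field K] [NumberField K],
      Kolyvagin1990_padicValNat_card_sha_le N W K)
    (hGZK : rank_eq_analyticRank_of_analyticRank_le_one) (hmod : hasEntireLFunction_rat)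
    (hnf : exists_isNewformOf)
    (hMz : mazur_not_dvd_maninConstant_of_odd)
    (hAU : abbesUllmo_not_dvd_maninConstant_of_not_dvd_level)
    (hC2 : cesnavicius_not_two_dvd_maninConstant_of_two_dvd_level)
    (W : WeierstrassCurve ℚ) [W.IsElliptic] [W.IsGloballyMinimal] (p : ℕ) [Fact p.Prime]
    (K : Type) [Field K] [NumberField K]
    (Wd : WeierstrassCurve ℚ) [Wd.IsElliptic] [Wd.IsGloballyMinimal] (Cd : VariableChange ℚ)
    (hr : W.analyticRank = 1) (hp2 : p ≠ 2) (hadd : Addv W p)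
    (hI : ∃ (v : HeightOneSpectrum ℤ) (n : ℕ), natGenerator v = p ∧ W.kodairaSymbolAt v = .Istar n)
    (hsurj : W.HasSurjectiveModNGaloisRep p) (htam : ¬ p ∣ W.tamagawaProduct)
    (hK : IsImaginaryQuadratic K) (hHN : SatisfiesHeegnerHypothesis (W.conductorNorm ℤ) K)
    (hLt : (W.quadraticTwist (NumberField.discr K : ℚ)).entireLFunction 1 ≠ 0)
    (hWd : Cd • W.quadraticTwist (NumberField.discr K : ℚ) = Wd)
    {qd : ℚ} (hqd : shaAn Wd = (qd : ℂ)) (hvd : padicValRat p qd ≤ 0)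
    {j : ℕ} {S : AddSubgroup (W.galH1Torsion (p : ℤ))} (hS : S ≤ W.selmerGroup (p : ℤ))
    (hcardS : Nat.card S = p ^ (1 + j)) {q : ℚ} (hq : shaAn W = (q : ℂ)) (hv : padicValRat p q ≤ j) :
    BSDp W p :=
  bsdp_rankOne_istar_of_lower_of_twistShaAnUnit hGZ hKo hB hGZK hmod hnf hMz hAU hC2 W p K Wd Cd hr hp2 hadd hI
    hsurj htam hK hHN hLt hWd hqd hvd
    (missingLowerBoundAt_rankOne_of_surj_of_card_addSubgroup_selmer hGZK W p hr hsurj hS hcardS hq hv)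

/-- **`BSD(E,p)` on cell (G) ∧ ss (`e = 2`) ∩ `r_an = 1`, every odd `p`: UPPER from ONE unit Heegner twist,
LOWER from an EXHIBITED Selmer subgroup of order `p^{1+j}`, `ord_p #Ш(E)_an ≤ j`** (type `Iₙ*` by Part 23b §13).
At `p = 3`, `j = 2`, `#S = 27` this is the road for the six live rows of the module docstring (LB3SUB
certificates of kit j293463 + the twist data of kit j292847). [cite: JetchevSkinnerWan2017, §7.4.1–7.4.3 (pp. 29–31)]
[cite: McCallumLMS1991, §1 Theorem (Kolyvagin), p. 296] [cite: SilvermanAEC2009, Thm. X.4.2(a)]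
[cite: SchaeferStoll2004, §1 and §5] [cite: Delbourgo1998, §1.5 (G)] [cite: Miller2011LMS, §1 and Def. 1.1] -/
theorem bsdp_rankOne_subGss_of_card_addSubgroup_selmer_of_twistShaAnUnit
    (hGZ : ∀ (N : ℕ) [NeZero N] (W : WeierstrassCurve ℚ) (K : Type) [Field K] [NumberField K],
      gross_zagier N W K)
    (hKo : ∀ (N : ℕ) [NeZero N] (W : WeierstrassCurve ℚ) (K : Type) [Field K] [NumberField K],
      kolyvagin N W K)
    (hB : ∀ (N : ℕ) [NeZero N] (W : WeierstrassCurve ℚ) (K : Type) [Field K] [NumberField K],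
      Kolyvagin1990_padicValNat_card_sha_le N W K)
    (hGZK : rank_eq_analyticRank_of_analyticRank_le_one) (hmod : hasEntireLFunction_rat)
    (hnf : exists_isNewformOf)
    (hMz : mazur_not_dvd_maninConstant_of_odd)
    (hAU : abbesUllmo_not_dvd_maninConstant_of_not_dvd_level)
    (hC2 : cesnavicius_not_two_dvd_maninConstant_of_two_dvd_level)
    (W : WeierstrassCurve ℚ) [W.IsElliptic] [W.IsGloballyMinimal] (p : ℕ) [Fact p.Prime]
    (K : Type) [Field K] [NumberField K]
    (Wd : WeierstrassCurve ℚ) [Wd.IsElliptic] [Wd.IsGloballyMinimal] (Cd : VariableChange ℚ)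
    (hr : W.analyticRank = 1) (hp2 : p ≠ 2) (hadd : Addv W p) (hss : SubGss W p)
    (hsurj : W.HasSurjectiveModNGaloisRep p) (htam : ¬ p ∣ W.tamagawaProduct)
    (hK : IsImaginaryQuadratic K) (hHN : SatisfiesHeegnerHypothesis (W.conductorNorm ℤ) K)
    (hLt : (W.quadraticTwist (NumberField.discr K : ℚ)).entireLFunction 1 ≠ 0)
    (hWd : Cd • W.quadraticTwist (NumberField.discr K : ℚ) = Wd)
    {qd : ℚ} (hqd : shaAn Wd = (qd : ℂ)) (hvd : padicValRat p qd ≤ 0)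
    {j : ℕ} {S : AddSubgroup (W.galH1Torsion (p : ℤ))} (hS : S ≤ W.selmerGroup (p : ℤ))
    (hcardS : Nat.card S = p ^ (1 + j)) {q : ℚ} (hq : shaAn W = (q : ℂ)) (hv : padicValRat p q ≤ j) :
    BSDp W p :=
  bsdp_rankOne_istar_of_card_addSubgroup_selmer_of_twistShaAnUnit hGZ hKo hB hGZK hmod hnf hMz hAU hC2 W p K Wd
    Cd hr hp2 hadd (exists_kodairaSymbolAt_eq_Istar_of_subGss W p hp2 hadd hss) hsurj htam hK hHN hLt hWd hqd hvd
    hS hcardS hq hv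

/-- **`BSD(E,3)` on cell (G) ∧ ss (`e = 2`) ∩ `r_an = 1` at `p = 3`, `#Ш(E)_an = 9·(3-adic unit)`: the LB3SUB
row shape** — an exhibited subgroup of `Sel^(3)(E/ℚ)` of order `27` + one unit Heegner twist + PUBLISHED facts.
The six census rows of the module docstring instantiate every displayed datum. Per pair; nothing booked.
[cite: JetchevSkinnerWan2017, §7.4.1–7.4.3 (pp. 29–31)] [cite: McCallumLMS1991, §1 Theorem (Kolyvagin), p. 296]
[cite: SilvermanAEC2009, Thm. X.4.2(a)] [cite: SchaeferStoll2004, §1 and §5] [cite: Miller2011LMS, §1 and Def. 1.1] -/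
theorem bsdp_three_rankOne_subGss_of_card_addSubgroup_selmerThree_of_twistShaAnUnit
    (hGZ : ∀ (N : ℕ) [NeZero N] (W : WeierstrassCurve ℚ) (K : Type) [Field K] [NumberField K],
      gross_zagier N W K)
    (hKo : ∀ (N : ℕ) [NeZero N] (W : WeierstrassCurve ℚ) (K : Type) [Field K] [NumberField K],
      kolyvagin N W K)
    (hB : ∀ (N : ℕ) [NeZero N] (W : WeierstrassCurve ℚ) (K : Type) [Field K] [NumberField K],
      Kolyvagin1990_padicValNat_card_sha_le N W K)
    (hGZK : rank_eq_analyticRank_of_analyticRank_le_one) (hmod : hasEntireLFunction_rat)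
    (hnf : exists_isNewformOf)
    (hMz : mazur_not_dvd_maninConstant_of_odd)
    (hAU : abbesUllmo_not_dvd_maninConstant_of_not_dvd_level)
    (hC2 : cesnavicius_not_two_dvd_maninConstant_of_two_dvd_level)
    (W : WeierstrassCurve ℚ) [W.IsElliptic] [W.IsGloballyMinimal] [Fact (Nat.Prime 3)]
    (K : Type) [Field K] [NumberField K]
    (Wd : WeierstrassCurve ℚ) [Wd.IsElliptic] [Wd.IsGloballyMinimal] (Cd : VariableChange ℚ)
    (hr : W.analyticRank = 1) (hadd : Addv W 3) (hss : SubGss W 3)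
    (hsurj : W.HasSurjectiveModNGaloisRep 3) (htam : ¬ 3 ∣ W.tamagawaProduct)
    (hK : IsImaginaryQuadratic K) (hHN : SatisfiesHeegnerHypothesis (W.conductorNorm ℤ) K)
    (hLt : (W.quadraticTwist (NumberField.discr K : ℚ)).entireLFunction 1 ≠ 0)
    (hWd : Cd • W.quadraticTwist (NumberField.discr K : ℚ) = Wd)
    {qd : ℚ} (hqd : shaAn Wd = (qd : ℂ)) (hvd : padicValRat 3 qd ≤ 0)
    {S : AddSubgroup (W.galH1Torsion (3 : ℤ))} (hS : S ≤ W.selmerGroup (3 : ℤ)) (hcardS : Nat.card S = 27)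
    {q : ℚ} (hq : shaAn W = (q : ℂ)) (hv : padicValRat 3 q ≤ 2) : BSDp W 3 :=
  bsdp_rankOne_subGss_of_card_addSubgroup_selmer_of_twistShaAnUnit hGZ hKo hB hGZK hmod hnf hMz hAU hC2 W 3 K Wd Cd
    hr (by norm_num) hadd hss hsurj htam hK hHN hLt hWd hqd hvd (j := 2) hS (hcardS.trans (by norm_num)) hq
    (by exact_mod_cast hv)

/-- **`BSD(E,p)` on cell (G-ord, `e = 2`) ∩ `r_an = 1` (crux 19358's rows), every odd `p`, `p ∣ #Ш(E)_an`
content rows: UPPER from ONE unit Heegner twist, LOWER from an exhibited Selmer subgroup** (type `Iₙ*` by Part 18a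
§29). No such row is residue in the ledger of record today (module docstring of Part 23b); recorded for symmetry.
[cite: JetchevSkinnerWan2017, §7.4.1–7.4.3 (pp. 29–31)] [cite: McCallumLMS1991, §1 Theorem (Kolyvagin), p. 296]
[cite: SilvermanAEC2009, Thm. X.4.2(a)] [cite: SchaeferStoll2004, §1 and §5] [cite: Miller2011LMS, §1 and Def. 1.1] -/
theorem bsdp_rankOne_cellGordTwo_odd_of_card_addSubgroup_selmer_of_twistShaAnUnit
    (hGZ : ∀ (N : ℕ) [NeZero N] (W : WeierstrassCurve ℚ) (K : Type) [Field K] [NumberField K],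
      gross_zagier N W K)
    (hKo : ∀ (N : ℕ) [NeZero N] (W : WeierstrassCurve ℚ) (K : Type) [Field K] [NumberField K],
      kolyvagin N W K)
    (hB : ∀ (N : ℕ) [NeZero N] (W : WeierstrassCurve ℚ) (K : Type) [Field K] [NumberField K],
      Kolyvagin1990_padicValNat_card_sha_le N W K)
    (hGZK : rank_eq_analyticRank_of_analyticRank_le_one) (hmod : hasEntireLFunction_rat)
    (hnf : exists_isNewformOf)
    (hMz : mazur_not_dvd_maninConstant_of_odd)
    (hAU : abbesUllmo_not_dvd_maninConstant_of_not_dvd_level)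
    (hC2 : cesnavicius_not_two_dvd_maninConstant_of_two_dvd_level)
    (W : WeierstrassCurve ℚ) [W.IsElliptic] [W.IsGloballyMinimal] (p : ℕ) [Fact p.Prime]
    (K : Type) [Field K] [NumberField K]
    (Wd : WeierstrassCurve ℚ) [Wd.IsElliptic] [Wd.IsGloballyMinimal] (Cd : VariableChange ℚ)
    (hr : W.analyticRank = 1) (hc2 : N10.CellGordTwo W p)
    (hsurj : W.HasSurjectiveModNGaloisRep p) (htam : ¬ p ∣ W.tamagawaProduct)
    (hK : IsImaginaryQuadratic K) (hHN : SatisfiesHeegnerHypothesis (W.conductorNorm ℤ) K)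
    (hLt : (W.quadraticTwist (NumberField.discr K : ℚ)).entireLFunction 1 ≠ 0)
    (hWd : Cd • W.quadraticTwist (NumberField.discr K : ℚ) = Wd)
    {qd : ℚ} (hqd : shaAn Wd = (qd : ℂ)) (hvd : padicValRat p qd ≤ 0)
    {j : ℕ} {S : AddSubgroup (W.galH1Torsion (p : ℤ))} (hS : S ≤ W.selmerGroup (p : ℤ))
    (hcardS : Nat.card S = p ^ (1 + j)) {q : ℚ} (hq : shaAn W = (q : ℂ)) (hv : padicValRat p q ≤ j) :
    BSDp W p :=
  bsdp_rankOne_istar_of_card_addSubgroup_selmer_of_twistShaAnUnit hGZ hKo hB hGZK hmod hnf hMz hAU hC2 W p K Wd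
    Cd hr hc2.1 hc2.2.1 (N10.exists_kodairaSymbolAt_eq_Istar_of_cellGordTwo W p hc2) hsurj htam hK hHN hLt hWd
    hqd hvd hS hcardS hq hv

end Summit.BirchSwinnertonDyer.BirchSwinnertonDyer.Theorems.AdditiveBranchIMCGordTwoRankOne.HeegnerKolyvagin

end
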